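import Summits.QuantumFields.YangMills.Theorems.BalabanUVNodesN26AtRecord13K2Stub
import Literature.MathematicalPhysics.QuantumFieldTheory.Balaban1983to89.Node00.Record13NumericsOfThm1CC1
import Literature.MathematicalPhysics.QuantumFieldTheory.Balaban1983to89.Node00.Record13SepLiveSelector

/-!
# DAG node N26 — B4 ∕ N26 ∕ crux K2's registered stub `stub_d4AtSlopeCont13` READ AT NODE 00's [15]-KEYED STAGE-13 WITNESS WITH THE C¹ CLASS LETTER
# `θ₁₅ᶜᶜ¹ = Node00.theta13OfThm1CC1 F N ε₀ ε₂₉ B₃ B₃' a₀ a₁` (node00-def-K0a FILE 13a `Node00/Record13NumericsOfThm1CC1.lean`, p505383): the θ₁₅ᶜ faces of p497784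
# (`…N26AtTheta13OfThm1C`) RE-ISSUED AT θ₁₅ᶜᶜ¹ — κ threshold DISCHARGED, N1 at the faithful letters as the inequality on the open letter `ε₂₉`, rows G ∧ Z ∧ N1 ∧ seam at one
# member for every positive slope, and the (D4) family road there

Cell `pub-ymgap`, YM-PLAN Track A (HUMAN RULING D-0062), seat `pub-ymgap-dag-n26-c` gen 9 (R134 acceleration seat, s2); helper for crux K2⁗ `EndpointGivenBR13Sep`
(stmt-QuantumFields-20291; rev-20 successor K2⁵ by token map).  Trigger (t22) of this lineage's HANDOFF («K0a re-keys the witness ⇒ twin of p497583 ∕ p497784, mechanical if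
`lf` unchanged»): K0a FILE 13a–c LANDED the C¹-class witness `θ₁₅ᶜᶜ¹(ε₀, ε₂₉; B₃, B₃', a₀, a₁) := theta13LiveOfNumerics F N (stage12NumericsOfThm1CC1 F.L ε₀ B₃ B₃' a₀ a₁) ε₂₉
(ζ, Rz, Zt of record)` (`theta13OfThm1CC1_eq`, `rfl`; one more [15] letter `B₃'` for the (1.9)∕C¹ class bound; `κ = 2·10⁴`, `γ = ½`, `ℓ₆ + 1 = F.L` UNCHANGED:
`theta13OfThm1CC1_κ`, `_γ`, `_ℓ₆_succ`) — the member plan g67 may re-base the registered K0⁵ skeleton on (V8-CALL (2): «v9 may re-base on θ₁₅ᶜᶜ¹»), and the family at which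
b2b-balaban-beta-an4 g131's rows-below ∕ family-generic (D4) theorems (G)∕(H) want «the CondsL rows at θ₁₅ᶜᶜ¹» (ym-nodeO-ideate P3 EVIDENCE-59: «the next typed input»).
Every proof below is p497784's with the token swap `theta13OfThm1C ↦ theta13OfThm1CC1`, `stage12NumericsOfThm1C ↦ stage12NumericsOfThm1CC1`, letters `(ε₀ ε₂₉ B₃ a₀ a₁) ↦
(ε₀ ε₂₉ B₃ B₃' a₀ a₁)` and K0a's `admissible_theta13OfThm1CC1 … hB hB' …`; §2's N26 face is keyed at def-T's bg-free CORE datum (plan g67 CORE-YES 2026-08-27).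

WHAT THIS FILE PROVES (0 sorry, 0 def; by-name instantiation over tree theorems + numerals):
* §0 `kappaThreshold_le_theta13OfThm1CC1` (the record-side κ threshold `20·(64·log 162 + 1)` holds AT θ₁₅ᶜᶜ¹: `kappaThreshold_le_2e4` ∘ K0a `kp_n10_theta13OfThm1CC1`),
  `provisos₁₃Core_theta13OfThm1CC1` (def-T's bg-free Core provisos at θ₁₅ᶜᶜ¹, HYPOTHESIS-FREE — K0a FILE 12a at the member),
  `C3act_c13OfRecord₁₂_theta13OfThm1CC1` (Lemma 3's activity constant at the letters of record of θ₁₅ᶜᶜ¹ is `2(F.L+2)⁴·A₁·K₀(c₀)`).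
* §1 N1 AT THE FAITHFUL STAGE-13 LETTERS `{ c₀ with ε₁ := ε₂₉ }` OF θ₁₅ᶜᶜ¹ (dag-ref-D READ-148∕156 shape, `ε₂₉` an OPEN letter): `condsL_faithful_theta13OfThm1CC1_iff`
  (⟺ [`2(F.L+2)⁴·A₁·K₀(c₀)·ε₂₉·e^{100001}·K₀(64,8)·576 ≤ 1`] ∧ [`e·576·K₀(64,8)² ≤ A₂`] — both κ rows PAID by the numeral), `…_iff_eps_le`, `…_of_eps_le` (USE form).
* §1b `exists_eps29_admissible_condsL_faithful_theta13OfThm1CC1`: for `0 < ε₀`, `0 ≤ B₃`, `0 ≤ B₃'`, `0 < a₀`, `0 < a₁` and any residual `c₀`, some `ε₂₉ > 0` with `4ε₂₉ < ε₀` at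
  which θ₁₅ᶜᶜ¹ is Stage-13 ADMISSIBLE (row G), carries `ZtUnity` (row Z) AND meets N1 at its faithful letters with the minimal `A₂ := e·576·K₀(64,8)²`.
* §1c THE (D1)∕(D4) SEAM ROW JOINED: `c13OfRecord₁₂_theta13OfThm1CC1_eq` (the letters of record of θ₁₅ᶜᶜ¹ are ε₂₉-blind), `remCoeffL_faithful_theta13OfThm1CC1_eq` (the (D4)
  remainder coefficient `K_rem,L` at the faithful letters is ONE number along the family), ★ `exists_eps29_rows_theta13OfThm1CC1`: FOR EVERY POSITIVE SLOPE `s`, one member meets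
  rows G, Z, N1 AND the seam `ε₂₉·K_rem,L ≤ s` at once (`ε₂₉` chosen last).
* §2 the (D4) family road AT θ₁₅ᶜᶜ¹ with N1 DISCHARGED modulo the displayed `hsmall₁` ∕ `hA₂` and NO κ hypothesis: `d4AtSlopeOfD1Record13_at_theta13OfThm1CC1_of_family` — the
  registered stub `stub_d4AtSlopeCont13`'s CONSEQUENT at `(F, θ₁₅ᶜᶜ¹, Lc, Nc)` in the stub's own letters (p494179 §1 at θ := θ₁₅ᶜᶜ¹, `hC` paid by §1);
  `betaContH_betaOfRecord₁₃_theta13OfThm1CC1_of_family` (B4 on the box at `betaOfRecord₁₃ F N θ₁₅ᶜᶜ¹`); `n26_datumOfRecord₁₃Core_theta13OfThm1CC1_of_family` (N26 =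
  `∃ γc > 0, BetaContH γc (datumOfRecord₁₃Core F N θ₁₅ᶜᶜ¹ (provisos₁₃Core_theta13OfThm1CC1 …)).βfun` at def-T's bg-free CORE datum OF RECORD OF θ₁₅ᶜᶜ¹, which EXISTS AS A TERM by
  §0's `provisos₁₃Core_theta13OfThm1CC1` (K0a FILE 12a `provisos₁₃Core_theta13LiveOfNumerics_of_hasResiduals`, hypothesis-free) — NO proviso hypothesis; every item edition's
  datum at θ₁₅ᶜᶜ¹ is this one by proof irrelevance).

HONEST FRAMING.  Every input of §2 is a DISPLAYED hypothesis of NODE O ∕ def-T (the Stage-12 [B13] family `lamF` of record, the (1.22) identification `hm` at the ₁₃ merged β, laws,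
seams, (190) data, (1.7) data, (C-leaf)); the (2.9) threshold `ε₂₉` must lie BELOW `1∕(2(F.L+2)⁴·A₁·K₀(c₀)·e^{100001}·K₀(64,8)·576)` (displayed `hsmall₁`); nothing of Bałaban's
analysis is asserted; the (D4) INSTANCE is 0∕1; `stub_d4AtSlopeCont13` ∕ K2⁗ NOT proved (its `∀ θ` ranges over members above the threshold too); N26 NOT discharged (VACATED ∕
(D4)-dependent; counts unmoved 5∕27 · A 5∕28); general `N`; one finite four-torus programme at fixed ε per run — NOT the continuum limit, NOT ℝ⁴, NOT OS, NOT a mass gap, NOT Clay.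
No `instance`, no `notation`, no `axiom`.
Sources (context): [I] = [Balaban1987RG1] CMP **109** (1987): (1.2) p. 260, (1.7) p. 261, (1.18) p. 263, (1.20)–(1.22) p. 264, (2.9) p. 266, (5.10) p. 293;
[II] = [Balaban1988RG2Cluster] CMP **116** (1988): p. 7 (after (1.21)), Lemma 3 (2.38) p. 20, p. 21 (after (2.39), after (2.41)); [III] = [Balaban1988Convergent] CMP **119** (1988):
(2.4) p. 255, (2.10) p. 256, (2.28) p. 259; [15] = [Balaban1985Variational]: Thm 1 p. 279; [Balaban1989LargeFieldI] CMP **122** (1989): (0.3) p. 176.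
-/

noncomputable section

open scoped Matrix.Norms.L2Operator

namespace Summit.QuantumFields.YangMills.Theorems.BalabanUVNodesN26AtTheta13OfThm1CC1

open Literature.MathematicalPhysics.QuantumFieldTheory.Balaban1983to89
open Literature.MathematicalPhysics.QuantumFieldTheory.Balaban1983to89.FlowStep
open Literature.MathematicalPhysics.QuantumFieldTheory.Balaban1983to89.T4Continuum (T4Family)
open Literature.MathematicalPhysics.QuantumFieldTheory.Balaban1983to89.Node00
open Literature.MathematicalPhysics.QuantumFieldTheory.Balaban1983to89.B13ScaleTransfer (Pt)
open Literature.MathematicalPhysics.QuantumFieldTheory.Balaban1983to89.B12TreeDecay (K₀ K₀_pos)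
open Literature.MathematicalPhysics.QuantumFieldTheory.Balaban1983to89.Beta.RemainderChainLattice
open Literature.MathematicalPhysics.QuantumFieldTheory.Balaban1983to89.TreeLengthTorus (TDom proj)
open Literature.MathematicalPhysics.QuantumFieldTheory.Balaban1983to89.B12Decay510 (mixedDeriv)
open Literature.MathematicalPhysics.QuantumFieldTheory.Balaban1983to89.Beta.RemainderLimitTorus (LDom limKernel tproj)
open Literature.MathematicalPhysics.QuantumFieldTheory.Balaban1983to89.Beta.RemainderWOfRecordB13
open Literature.MathematicalPhysics.QuantumFieldTheory.Balaban1983to89.Beta.RemainderDecay190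
open Summit.QuantumFields.BalabanUV.Gaps
open Summit.QuantumFields.BalabanUV.Gaps.BetaContFromD4Chain
open Summit.QuantumFields.YangMills.Theorems.BalabanUVNodesN26AtRecord12KappaSufficient (C3act_c13OfRecord₁₂ kappaThreshold_le_2e4)
open Summit.QuantumFields.YangMills.Theorems.BalabanUVNodesN26AtRecord13 (betaContH_betaOfRecord₁₃_of_family)
open Summit.QuantumFields.YangMills.Theorems.BalabanUVNodesN26AtRecord13Family (condsL_faithful_theta13LiveOfNumerics_iff_of_kappa_ge)
open Summit.QuantumFields.YangMills.Theorems.BalabanUVNodesN26AtRecord13K2Stub (d4AtSlopeOfD1Record13_at_of_family_faithful)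
open Metric
open Filter Topology

variable (F : T4Family) (N : ℕ) [NeZero N]

/-! ## §0 Faces of θ₁₅ᶜᶜ¹ this lineage reads: the κ threshold and Lemma 3's activity constant -/

section Faces

variable (ε₀ ε₂₉ B₃ B₃' a₀ a₁ : ℝ) (c₀ : B13.Consts)

/-- **The record-side κ threshold `20·(64·log 162 + 1)` (≈ 6532) HOLDS AT θ₁₅ᶜᶜ¹** (K0a's `kp_n10_theta13OfThm1CC1`: `2·10⁴ ≤ κ`; p485881 `kappaThreshold_le_2e4`) — the `hκ` slot of
p494179 §3 ∕ p492818 §2 at the member `n := stage12NumericsOfThm1CC1 F.L ε₀ B₃ B₃' a₀ a₁`, discharged. [cite: Balaban1988RG2Cluster, p.21 (after (2.39)); Balaban1987RG1, (1.18) p.263 (bookkeeping numeral)] -/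
theorem kappaThreshold_le_theta13OfThm1CC1 :
    20 * (64 * Real.log 162 + 1) ≤ (theta13OfThm1CC1 F N ε₀ ε₂₉ B₃ B₃' a₀ a₁).s2.lf.κ :=
  kappaThreshold_le_2e4.trans (kp_n10_theta13OfThm1CC1 F N ε₀ ε₂₉ B₃ B₃' a₀ a₁)

/-- **def-T's bg-FREE CORE PROVISOS HOLD AT θ₁₅ᶜᶜ¹ AS A THEOREM** (every `ε₀ ε₂₉ B₃ B₃' a₀ a₁`, no hypothesis): K0a FILE 12a `provisos₁₃Core_theta13LiveOfNumerics_of_hasResiduals` at the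
member `n := stage12NumericsOfThm1CC1 F.L ε₀ B₃ B₃' a₀ a₁` (`theta13OfThm1CC1_eq`, `rfl`) — so the CORE DATUM OF RECORD OF θ₁₅ᶜᶜ¹ `datumOfRecord₁₃Core F N θ₁₅ᶜᶜ¹ (provisos₁₃Core_theta13OfThm1CC1 …)`
EXISTS AS A TERM, and §2's N26 face needs no proviso hypothesis (row `bg` ∕ the v1.3 guard fields are the ITEM's, not N26's). [cite: Balaban1988Convergent, (2.18) p.257, (3.16) p.268, (3.22) p.269; Balaban1989LargeFieldI, (0.3)–(0.4) p.176 (bookkeeping)] -/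
theorem provisos₁₃Core_theta13OfThm1CC1 : (theta13OfThm1CC1 F N ε₀ ε₂₉ B₃ B₃' a₀ a₁).Provisos₁₃Core F N :=
  provisos₁₃Core_theta13LiveOfNumerics_of_hasResiduals F N (stage12NumericsOfThm1CC1 F.L ε₀ B₃ B₃' a₀ a₁) ε₂₉

/-- **Face: Lemma 3's activity constant at the letters of record OF θ₁₅ᶜᶜ¹**: `C₃ = 2(F.L+2)⁴·A₁·K₀(c₀)` (block size `F.L`, `E₀ = 1`; independent of `ε₀`, `ε₂₉`, `B₃`, `a₀`, `a₁`).
[cite: Balaban1988RG2Cluster, p.20 (definition of C₃; bookkeeping numeral); Balaban1987RG1, (0.1) p.251] -/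
theorem C3act_c13OfRecord₁₂_theta13OfThm1CC1 :
    (c13OfRecord₁₂ F N (theta13OfThm1CC1 F N ε₀ ε₂₉ B₃ B₃' a₀ a₁).toStage12Params c₀).C3act = 2 * ((F.L : ℝ) + 2) ^ 4 * c₀.A₁ * c₀.K₀ := by
  rw [C3act_c13OfRecord₁₂, show (theta13OfThm1CC1 F N ε₀ ε₂₉ B₃ B₃' a₀ a₁).toStage12Params.ℓ₆ + 1 = F.L from theta13OfThm1CC1_ℓ₆_succ F N ε₀ ε₂₉ B₃ B₃' a₀ a₁,
    show (theta13OfThm1CC1 F N ε₀ ε₂₉ B₃ B₃' a₀ a₁).toStage12Params.s2.lf.E₀ = 1 from rfl]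
  ring

end Faces

/-! ## §1 N1 at the FAITHFUL Stage-13 letters `{ c₀ with ε₁ := ε₂₉ }` of θ₁₅ᶜᶜ¹: both κ rows paid; left, the small row in `ε₂₉` and the `A₂` row -/

section Faithful

variable (ε₀ ε₂₉ B₃ B₃' a₀ a₁ : ℝ) (c₀ : B13.Consts)

/-- **N1 AT THE FAITHFUL STAGE-13 LETTERS OF θ₁₅ᶜᶜ¹ IS THE SMALL ROW IN `ε₂₉` AND THE `A₂` ROW** (both κ rows DISCHARGED by `κ = 2·10⁴`):
`CondsL 4 (c13OfRecord₁₂ θ₁₅ᶜᶜ¹.toStage12Params { c₀ with ε₁ := ε₂₉ }) (½L)` ⟺ [`2(F.L+2)⁴·A₁·K₀(c₀)·ε₂₉·e^{100001}·K₀(64,8)·576 ≤ 1`] ∧ [`e·576·K₀(64,8)² ≤ A₂`] (p492818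
`condsL_faithful_theta13LiveOfNumerics_iff_of_kappa_ge` at the member, `hκ` by §0). [cite: Balaban1988RG2Cluster, p.7 (after (1.21)), p.21 (after (2.39) and after (2.41)); Balaban1987RG1, (1.18) p.263 and (2.9) p.266] -/
theorem condsL_faithful_theta13OfThm1CC1_iff :
    CondsL 4 (c13OfRecord₁₂ F N (theta13OfThm1CC1 F N ε₀ ε₂₉ B₃ B₃' a₀ a₁).toStage12Params { c₀ with ε₁ := ε₂₉ })
        (((c13OfRecord₁₂ F N (theta13OfThm1CC1 F N ε₀ ε₂₉ B₃ B₃' a₀ a₁).toStage12Params { c₀ with ε₁ := ε₂₉ }).L : ℝ) / 2) ↔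
      2 * ((F.L : ℝ) + 2) ^ 4 * c₀.A₁ * c₀.K₀ * ε₂₉ * Real.exp (5 * 20000 + 1) * K₀ 64 8 * 9 * 64 ≤ 1 ∧
        Real.exp 1 * 9 * 64 * K₀ 64 8 ^ 2 ≤ c₀.A₂ := by
  have h := condsL_faithful_theta13LiveOfNumerics_iff_of_kappa_ge F N ε₂₉
    (zeta316OfRecord F N (stage12NumericsOfThm1CC1 F.L ε₀ B₃ B₃' a₀ a₁).ν (stage12NumericsOfThm1CC1 F.L ε₀ B₃ B₃' a₀ a₁).τ9.M (stage12NumericsOfThm1CC1 F.L ε₀ B₃ B₃' a₀ a₁).A₁)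
    (RzOfRecord F N) (ZtOfRecord F N) c₀ (n := stage12NumericsOfThm1CC1 F.L ε₀ B₃ B₃' a₀ a₁)
    (kappaThreshold_le_theta13OfThm1CC1 F N ε₀ ε₂₉ B₃ B₃' a₀ a₁)
  rw [show (stage12NumericsOfThm1CC1 F.L ε₀ B₃ B₃' a₀ a₁).s2.lf.E₀ = 1 from rfl, show (stage12NumericsOfThm1CC1 F.L ε₀ B₃ B₃' a₀ a₁).s2.lf.κ = 20000 from rfl,
    one_mul] at h
  exact h

/-- **THE SMALL ROW AS THE INEQUALITY ON THE OPEN LETTER** (for `A₁·K₀(c₀) > 0`): N1 at the faithful letters of θ₁₅ᶜᶜ¹ ⟺ [`ε₂₉ ≤ 1 ∕ (2(F.L+2)⁴·A₁·K₀(c₀)·e^{100001}·K₀(64,8)·576)`] ∧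
[`e·576·K₀(64,8)² ≤ A₂`]. [cite: Balaban1988RG2Cluster, p.7 (after (1.21)) and p.21 (after (2.39)); Balaban1987RG1, (2.9) p.266] -/
theorem condsL_faithful_theta13OfThm1CC1_iff_eps_le (hP : 0 < c₀.A₁ * c₀.K₀) :
    CondsL 4 (c13OfRecord₁₂ F N (theta13OfThm1CC1 F N ε₀ ε₂₉ B₃ B₃' a₀ a₁).toStage12Params { c₀ with ε₁ := ε₂₉ })
        (((c13OfRecord₁₂ F N (theta13OfThm1CC1 F N ε₀ ε₂₉ B₃ B₃' a₀ a₁).toStage12Params { c₀ with ε₁ := ε₂₉ }).L : ℝ) / 2) ↔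
      ε₂₉ ≤ 1 / (2 * ((F.L : ℝ) + 2) ^ 4 * c₀.A₁ * c₀.K₀ * Real.exp (5 * 20000 + 1) * K₀ 64 8 * 9 * 64) ∧
        Real.exp 1 * 9 * 64 * K₀ 64 8 ^ 2 ≤ c₀.A₂ := by
  rw [condsL_faithful_theta13OfThm1CC1_iff]
  have hK := K₀_pos 64 8
  have hpos : 0 < 2 * ((F.L : ℝ) + 2) ^ 4 * c₀.A₁ * c₀.K₀ * Real.exp (5 * 20000 + 1) * K₀ 64 8 * 9 * 64 := by
    have e : 2 * ((F.L : ℝ) + 2) ^ 4 * c₀.A₁ * c₀.K₀ = 2 * ((F.L : ℝ) + 2) ^ 4 * (c₀.A₁ * c₀.K₀) := by ring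
    rw [e]
    positivity
  rw [le_div_iff₀ hpos]
  have e : ε₂₉ * (2 * ((F.L : ℝ) + 2) ^ 4 * c₀.A₁ * c₀.K₀ * Real.exp (5 * 20000 + 1) * K₀ 64 8 * 9 * 64) =
      2 * ((F.L : ℝ) + 2) ^ 4 * c₀.A₁ * c₀.K₀ * ε₂₉ * Real.exp (5 * 20000 + 1) * K₀ 64 8 * 9 * 64 := by ring
  rw [e]

variable {ε₂₉ c₀} in
/-- **USE FORM — N1 AT THE FAITHFUL LETTERS OF θ₁₅ᶜᶜ¹ FROM THE TWO DISPLAYED INEQUALITIES** `hsmall` (the open letter below the threshold) and `hA₂` (the printed O(1) of (2.41) at least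
`e·576·K₀(64,8)²`): the `hC` slot of every family-road theorem of this lineage at θ₁₅ᶜᶜ¹, discharged modulo them. [cite: Balaban1988RG2Cluster, p.21 (after (2.39) and after (2.41)); Balaban1987RG1, (1.18) p.263 and (2.9) p.266] -/
theorem condsL_faithful_theta13OfThm1CC1_of_eps_le
    (hsmall : 2 * ((F.L : ℝ) + 2) ^ 4 * c₀.A₁ * c₀.K₀ * ε₂₉ * Real.exp (5 * 20000 + 1) * K₀ 64 8 * 9 * 64 ≤ 1)
    (hA₂ : Real.exp 1 * 9 * 64 * K₀ 64 8 ^ 2 ≤ c₀.A₂) :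
    CondsL 4 (c13OfRecord₁₂ F N (theta13OfThm1CC1 F N ε₀ ε₂₉ B₃ B₃' a₀ a₁).toStage12Params { c₀ with ε₁ := ε₂₉ })
      (((c13OfRecord₁₂ F N (theta13OfThm1CC1 F N ε₀ ε₂₉ B₃ B₃' a₀ a₁).toStage12Params { c₀ with ε₁ := ε₂₉ }).L : ℝ) / 2) :=
  (condsL_faithful_theta13OfThm1CC1_iff F N ε₀ ε₂₉ B₃ B₃' a₀ a₁ c₀).2 ⟨hsmall, hA₂⟩

/-! ## §1b ★ Rows G, Z and N26's N1 row JOINTLY at ONE member of the [15]-keyed family: `ε₂₉` chosen after `ε₀`, `B₃`, `a₀`, `a₁`, `c₀` -/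

variable {ε₀ B₃ B₃' a₀ a₁} in
/-- **ONE MEMBER OF THE [15]-KEYED FAMILY MEETING ROW G, ROW Z AND N26's N1 ROW AT ONCE**: for every `ε₀ > 0`, `B₃ ≥ 0`, `a₀ > 0`, `a₁ > 0` and residual `c₀` there is a (2.9) threshold
`ε₂₉ > 0` with `4ε₂₉ < ε₀` (K0e's hierarchy room `δ + 4ε₂₉ ≤ ε₀`) at which θ₁₅ᶜᶜ¹(ε₀, ε₂₉; B₃, a₀, a₁) is Stage-13 ADMISSIBLE (K0a `admissible_theta13OfThm1CC1`), carries `ZtUnity` (K0a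
`ztUnity_theta13OfThm1CC1`, every member), AND meets N1 at its faithful Stage-13 letters with the minimal `A₂ := e·576·K₀(64,8)²` — namely any
`ε₂₉ ≤ min(ε₀ ∕ 8, 1 ∕ (|2(F.L+2)⁴·A₁·K₀(c₀)·e^{100001}·K₀(64,8)·576| + 1))`.  Satisfiability of the displayed rows together at the K0 candidate family; nothing of Bałaban's;
the other displayed inputs of §2 and the rows of the other nodes are untouched (an extra UPPER bound on `ε₂₉` composes by `min`).
[cite: Balaban1987RG1, (0.21) p.256, (1.2) p.260 and (2.9) p.266; Balaban1988Convergent, (2.10) p.256, (3.16)–(3.20) pp.268–269; Balaban1985Variational, Thm 1 p.279; Balaban1988RG2Cluster, p.21 (after (2.39) and after (2.41))] -/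
theorem exists_eps29_admissible_condsL_faithful_theta13OfThm1CC1 (hε : 0 < ε₀) (hB : 0 ≤ B₃) (hB' : 0 ≤ B₃') (ha₀ : 0 < a₀) (ha₁ : 0 < a₁) :
    ∃ ε₂₉ : ℝ, 0 < ε₂₉ ∧ 4 * ε₂₉ < ε₀ ∧
      (theta13OfThm1CC1 F N ε₀ ε₂₉ B₃ B₃' a₀ a₁).Admissible F N ∧ (theta13OfThm1CC1 F N ε₀ ε₂₉ B₃ B₃' a₀ a₁).ZtUnity F N ∧
      CondsL 4 (c13OfRecord₁₂ F N (theta13OfThm1CC1 F N ε₀ ε₂₉ B₃ B₃' a₀ a₁).toStage12Params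
          { c₀ with ε₁ := ε₂₉, A₂ := Real.exp 1 * 9 * 64 * K₀ 64 8 ^ 2 })
        (((c13OfRecord₁₂ F N (theta13OfThm1CC1 F N ε₀ ε₂₉ B₃ B₃' a₀ a₁).toStage12Params
          { c₀ with ε₁ := ε₂₉, A₂ := Real.exp 1 * 9 * 64 * K₀ 64 8 ^ 2 }).L : ℝ) / 2) := by
  set P : ℝ := 2 * ((F.L : ℝ) + 2) ^ 4 * c₀.A₁ * c₀.K₀ * Real.exp (5 * 20000 + 1) * K₀ 64 8 * 9 * 64 with hP
  have hm0 : 0 < min (ε₀ / 8) (1 / (|P| + 1)) := lt_min (by positivity) (by positivity)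
  refine ⟨min (ε₀ / 8) (1 / (|P| + 1)), hm0, ?_, admissible_theta13OfThm1CC1 F N hε hm0 hB hB' ha₀ ha₁,
    ztUnity_theta13OfThm1CC1 F N ε₀ _ B₃ B₃' a₀ a₁, ?_⟩
  · have h := min_le_left (ε₀ / 8) (1 / (|P| + 1))
    linarith
  · refine condsL_faithful_theta13OfThm1CC1_of_eps_le F N ε₀ B₃ B₃' a₀ a₁ (c₀ := { c₀ with A₂ := Real.exp 1 * 9 * 64 * K₀ 64 8 ^ 2 }) ?_ le_rfl
    show 2 * ((F.L : ℝ) + 2) ^ 4 * c₀.A₁ * c₀.K₀ * min (ε₀ / 8) (1 / (|P| + 1)) * Real.exp (5 * 20000 + 1) * K₀ 64 8 * 9 * 64 ≤ 1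
    have hm1 : min (ε₀ / 8) (1 / (|P| + 1)) ≤ 1 / (|P| + 1) := min_le_right _ _
    have e : 2 * ((F.L : ℝ) + 2) ^ 4 * c₀.A₁ * c₀.K₀ * min (ε₀ / 8) (1 / (|P| + 1)) * Real.exp (5 * 20000 + 1) * K₀ 64 8 * 9 * 64 =
        P * min (ε₀ / 8) (1 / (|P| + 1)) := by rw [hP]; ring
    rw [e]
    calc P * min (ε₀ / 8) (1 / (|P| + 1)) ≤ |P| * min (ε₀ / 8) (1 / (|P| + 1)) :=
          mul_le_mul_of_nonneg_right (le_abs_self P) hm0.le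
      _ ≤ |P| * (1 / (|P| + 1)) := mul_le_mul_of_nonneg_left hm1 (abs_nonneg P)
      _ = |P| / (|P| + 1) := by ring
      _ ≤ 1 := by rw [div_le_one (by positivity)]; linarith

end Faithful

/-! ## §1c ★ … AND THE (D1)∕(D4) SEAM ROW: for every positive slope, ONE member meets rows G, Z, N26's N1 row and `ε₂₉·K_rem,L ≤ s` at once -/

section Seam

variable (ε₀ B₃ B₃' a₀ a₁ : ℝ) (c₀ : B13.Consts) (M : ℕ) (α₂ B : ℝ)

/-- **The letters of record of θ₁₅ᶜᶜ¹ do not read the witness's (2.9) threshold**: `c13OfRecord₁₂` reads `ℓ₆, γ, s2` of the Stage-12 part only (`L := ℓ₆ + 1`, `δ`, `γ`, `E₀`, `κ`), and along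
the family `e ↦ θ₁₅ᶜᶜ¹(ε₀, e; B₃, a₀, a₁)` these are `F.L − 1`, `½`, `sect2NumericsOfFamily` (K0a's `theta13OfThm1CC1_ℓ₆_succ ∕ _γ ∕ _s2`). [cite: Balaban1988RG2Cluster, p.9, p.21 (after (2.41)); Balaban1987RG1, (0.1) p.251, (1.18) p.263 (bookkeeping)] -/
theorem c13OfRecord₁₂_theta13OfThm1CC1_eq (e e' : ℝ) (c : B13.Consts) :
    c13OfRecord₁₂ F N (theta13OfThm1CC1 F N ε₀ e B₃ B₃' a₀ a₁).toStage12Params c = c13OfRecord₁₂ F N (theta13OfThm1CC1 F N ε₀ e' B₃ B₃' a₀ a₁).toStage12Params c := by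
  have hℓ : (theta13OfThm1CC1 F N ε₀ e B₃ B₃' a₀ a₁).ℓ₆ = (theta13OfThm1CC1 F N ε₀ e' B₃ B₃' a₀ a₁).ℓ₆ :=
    Nat.add_right_cancel ((theta13OfThm1CC1_ℓ₆_succ F N ε₀ e B₃ B₃' a₀ a₁).trans (theta13OfThm1CC1_ℓ₆_succ F N ε₀ e' B₃ B₃' a₀ a₁).symm)
  have hγ : (theta13OfThm1CC1 F N ε₀ e B₃ B₃' a₀ a₁).γ = (theta13OfThm1CC1 F N ε₀ e' B₃ B₃' a₀ a₁).γ := by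
    rw [theta13OfThm1CC1_γ, theta13OfThm1CC1_γ]
  have hs : (theta13OfThm1CC1 F N ε₀ e B₃ B₃' a₀ a₁).s2 = (theta13OfThm1CC1 F N ε₀ e' B₃ B₃' a₀ a₁).s2 := by
    rw [theta13OfThm1CC1_s2, theta13OfThm1CC1_s2]
  simp only [c13OfRecord₁₂, hℓ, hγ, hs]

/-- **The (D4) remainder coefficient `K_rem,L` at the faithful letters of θ₁₅ᶜᶜ¹ READS NEITHER THE WITNESS's (2.9) THRESHOLD NOR THE ACTIVITY LETTER**: `remCoeffL 4 M c α₂ B =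
A₂·C₃·β′₄(K_Π,L(κ, δ₀), δ₁(κ, δ₀))` reads `A₂, A₁, E₀, K₀(c), L, κ, δ₀` only (`Beta.RemainderResidue.remCoeffL_constsAt`, `rfl`), and the letters of record do not see `ε₂₉`
(`c13OfRecord₁₂_theta13OfThm1CC1_eq`); so along the family `e ↦ θ₁₅ᶜᶜ¹(ε₀, e; B₃, a₀, a₁)` the seam coefficient is ONE number, that of the member `e = 0` at the residual `c₀`.
[cite: Balaban1988RG2Cluster, (2.38) p.20 and p.21 (after (2.41)); Balaban1987RG1, (1.22) p.264 and (5.10) p.293 (bookkeeping)] -/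
theorem remCoeffL_faithful_theta13OfThm1CC1_eq (e x : ℝ) :
    remCoeffL 4 M (c13OfRecord₁₂ F N (theta13OfThm1CC1 F N ε₀ e B₃ B₃' a₀ a₁).toStage12Params { c₀ with ε₁ := x }) α₂ B =
      remCoeffL 4 M (c13OfRecord₁₂ F N (theta13OfThm1CC1 F N ε₀ 0 B₃ B₃' a₀ a₁).toStage12Params c₀) α₂ B := by
  rw [c13OfRecord₁₂_theta13OfThm1CC1_eq F N ε₀ B₃ B₃' a₀ a₁ e 0]
  rfl

variable {ε₀ B₃ B₃' a₀ a₁} in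
/-- **★ FOR EVERY POSITIVE SLOPE `s`, ONE MEMBER OF THE [15]-KEYED FAMILY MEETS ROW G, ROW Z, N26's N1 ROW AND THE (D1)∕(D4) SEAM ROW `ε₂₉·K_rem,L ≤ s` AT ONCE** — the β-side rows
of crux K2⁗∕K2⁵ that read the (2.9) threshold (ym-nodeO-ideate P3 EVIDENCE-54 v3 §10 (T6‴): the (D4) letters' `CondsL`-faithful membership + the seam row; both smallness of `ε₂₉`) are
JOINTLY payable at node00-def-K0a's K0 candidate family by choosing `ε₂₉` LAST: any `0 < ε₂₉ ≤ min(ε₀∕8, 1∕(|C|+1), s∕(|K|+1))` with `C := 2(F.L+2)⁴·A₁·K₀(c₀)·e^{100001}·K₀(64,8)·576` and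
`K := K_rem,L` of §1c's `remCoeffL_faithful_theta13OfThm1CC1_eq`.  The slope `s` is a free positive letter here: at a (D1) datum `(Lc, Js, Nc)` of the member it is `stepBal Nc Lc`
(crux K2⁗∕K2⁵'s `D4AtSlopeOfD1Record13`); whether the members' (D1) slopes admit a common positive lower bound as `ε₂₉ ↓ 0` (print: the one-loop number `β⁰_{k+1}` does not read the (2.9)
threshold, [I] (2.12)–(2.13) p. 268) is the (D1) lane's sentence, displayed by keeping `s` free.  Satisfiability of the displayed rows together; nothing of Bałaban's; instance 0∕1.
[cite: Balaban1987RG1, (0.21) p.256, (1.2) p.260, (2.9) p.266, (2.12)–(2.13) p.268 and (1.22) p.264; Balaban1988RG2Cluster, Lemma 3 (2.38) p.20 and p.21 (after (2.39), after (2.41)); Balaban1988Convergent, (2.10) p.256; Balaban1985Variational, Thm 1 p.279] -/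
theorem exists_eps29_rows_theta13OfThm1CC1 (hε : 0 < ε₀) (hB : 0 ≤ B₃) (hB' : 0 ≤ B₃') (ha₀ : 0 < a₀) (ha₁ : 0 < a₁) {s : ℝ} (hs : 0 < s) :
    ∃ ε₂₉ : ℝ, 0 < ε₂₉ ∧ 4 * ε₂₉ < ε₀ ∧
      (theta13OfThm1CC1 F N ε₀ ε₂₉ B₃ B₃' a₀ a₁).Admissible F N ∧ (theta13OfThm1CC1 F N ε₀ ε₂₉ B₃ B₃' a₀ a₁).ZtUnity F N ∧
      CondsL 4 (c13OfRecord₁₂ F N (theta13OfThm1CC1 F N ε₀ ε₂₉ B₃ B₃' a₀ a₁).toStage12Params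
          { c₀ with ε₁ := ε₂₉, A₂ := Real.exp 1 * 9 * 64 * K₀ 64 8 ^ 2 })
        (((c13OfRecord₁₂ F N (theta13OfThm1CC1 F N ε₀ ε₂₉ B₃ B₃' a₀ a₁).toStage12Params
          { c₀ with ε₁ := ε₂₉, A₂ := Real.exp 1 * 9 * 64 * K₀ 64 8 ^ 2 }).L : ℝ) / 2) ∧
      ε₂₉ * remCoeffL 4 M (c13OfRecord₁₂ F N (theta13OfThm1CC1 F N ε₀ ε₂₉ B₃ B₃' a₀ a₁).toStage12Params
          { c₀ with ε₁ := ε₂₉, A₂ := Real.exp 1 * 9 * 64 * K₀ 64 8 ^ 2 }) α₂ B ≤ s := by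
  set P : ℝ := 2 * ((F.L : ℝ) + 2) ^ 4 * c₀.A₁ * c₀.K₀ * Real.exp (5 * 20000 + 1) * K₀ 64 8 * 9 * 64 with hP
  set K : ℝ := remCoeffL 4 M (c13OfRecord₁₂ F N (theta13OfThm1CC1 F N ε₀ 0 B₃ B₃' a₀ a₁).toStage12Params
    { c₀ with A₂ := Real.exp 1 * 9 * 64 * K₀ 64 8 ^ 2 }) α₂ B with hK
  set e : ℝ := min (min (ε₀ / 8) (1 / (|P| + 1))) (s / (|K| + 1)) with he
  have he0 : 0 < e := lt_min (lt_min (by positivity) (by positivity)) (by positivity)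
  have he1 : e ≤ ε₀ / 8 := (min_le_left _ _).trans (min_le_left _ _)
  have he2 : e ≤ 1 / (|P| + 1) := (min_le_left _ _).trans (min_le_right _ _)
  have he3 : e ≤ s / (|K| + 1) := min_le_right _ _
  refine ⟨e, he0, by linarith, admissible_theta13OfThm1CC1 F N hε he0 hB hB' ha₀ ha₁, ztUnity_theta13OfThm1CC1 F N ε₀ _ B₃ B₃' a₀ a₁, ?_, ?_⟩
  · refine condsL_faithful_theta13OfThm1CC1_of_eps_le F N ε₀ B₃ B₃' a₀ a₁ (c₀ := { c₀ with A₂ := Real.exp 1 * 9 * 64 * K₀ 64 8 ^ 2 }) ?_ le_rfl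
    show 2 * ((F.L : ℝ) + 2) ^ 4 * c₀.A₁ * c₀.K₀ * e * Real.exp (5 * 20000 + 1) * K₀ 64 8 * 9 * 64 ≤ 1
    have eq : 2 * ((F.L : ℝ) + 2) ^ 4 * c₀.A₁ * c₀.K₀ * e * Real.exp (5 * 20000 + 1) * K₀ 64 8 * 9 * 64 = P * e := by
      rw [hP]; ring
    rw [eq]
    calc P * e ≤ |P| * e := mul_le_mul_of_nonneg_right (le_abs_self P) he0.le
      _ ≤ |P| * (1 / (|P| + 1)) := mul_le_mul_of_nonneg_left he2 (abs_nonneg P)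
      _ = |P| / (|P| + 1) := by ring
      _ ≤ 1 := by rw [div_le_one (by positivity)]; linarith
  · rw [remCoeffL_faithful_theta13OfThm1CC1_eq F N ε₀ B₃ B₃' a₀ a₁ { c₀ with A₂ := Real.exp 1 * 9 * 64 * K₀ 64 8 ^ 2 } M α₂ B e e, ← hK]
    calc e * K ≤ e * |K| := mul_le_mul_of_nonneg_left (le_abs_self K) he0.le
      _ ≤ s / (|K| + 1) * |K| := mul_le_mul_of_nonneg_right he3 (abs_nonneg K)
      _ = s * (|K| / (|K| + 1)) := by ring
      _ ≤ s * 1 := mul_le_mul_of_nonneg_left (by rw [div_le_one (by positivity)]; linarith) hs.le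
      _ = s := mul_one s

end Seam

/-! ## §2 The (D4) family road AT θ₁₅ᶜᶜ¹: crux K2⁗∕K2⁵'s registered stub's consequent, B4 and N26 at `betaOfRecord₁₃ F N θ₁₅ᶜᶜ¹`, N1 DISCHARGED modulo `hsmall₁` ∕ `hA₂`, NO κ hypothesis -/

section RoadAtTheta15


variable {γ₀ : ℝ} {M : ℕ} [NeZero M] {μ ν : Fin 4} {α₂ : ℝ} {q : Consts190}
variable (ε₀ ε₂₉ B₃ B₃' a₀ a₁ : ℝ) (c₀ : B13.Consts)
  (lamF : ResidB13Fam₁₂ F N (theta13OfThm1CC1 F N ε₀ ε₂₉ B₃ B₃' a₀ a₁).toStage12Params) (hγ₀ : 0 < γ₀) (hle : γ₀ ≤ (theta13OfThm1CC1 F N ε₀ ε₂₉ B₃ B₃' a₀ a₁).γ)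
  (A1 : (k : ℕ) → (Fin (k + 1) → ℝ) → LDom 4 → Pt 4 → ℝ)
  (hm : letI := (theta13OfThm1CC1 F N ε₀ ε₂₉ B₃ B₃' a₀ a₁).instVβ₁; letI := (theta13OfThm1CC1 F N ε₀ ε₂₉ B₃ B₃' a₀ a₁).instVβ₂
    letI := (theta13OfThm1CC1 F N ε₀ ε₂₉ B₃ B₃' a₀ a₁).instιβ
    ∀ k (v : Fin (k + 1) → ℝ), v ∈ Box γ₀ k →
      betaMerged F (mergedTermFamilyMatT F N (TcanOfRecord F N)
          (chiFixed29 F N (theta13OfThm1CC1 F N ε₀ ε₂₉ B₃ B₃' a₀ a₁).ν (theta13OfThm1CC1 F N ε₀ ε₂₉ B₃ B₃' a₀ a₁).ε₂₉)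
          (theta13OfThm1CC1 F N ε₀ ε₂₉ B₃ B₃' a₀ a₁).εbg) (theta13OfThm1CC1 F N ε₀ ε₂₉ B₃ B₃' a₀ a₁).ρ8
          (theta13OfThm1CC1 F N ε₀ ε₂₉ B₃ B₃' a₀ a₁).bV k v =
        beta0OfMerged (betaMerged F (mergedTermFamilyMatT F N (TcanOfRecord F N)
            (chiFixed29 F N (theta13OfThm1CC1 F N ε₀ ε₂₉ B₃ B₃' a₀ a₁).ν (theta13OfThm1CC1 F N ε₀ ε₂₉ B₃ B₃' a₀ a₁).ε₂₉)
            (theta13OfThm1CC1 F N ε₀ ε₂₉ B₃ B₃' a₀ a₁).εbg) (theta13OfThm1CC1 F N ε₀ ε₂₉ B₃ B₃' a₀ a₁).ρ8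
            (theta13OfThm1CC1 F N ε₀ ε₂₉ B₃ B₃' a₀ a₁).bV) (theta13OfThm1CC1 F N ε₀ ε₂₉ B₃ B₃' a₀ a₁).v₀ k +
          B12Beta.secondMoment (fun _ _ => limKernel (A1 k v)) μ ν)
  (hcF : ∀ P k v, v ∈ Box γ₀ k →
    (lamF P k v).c = c13OfRecord₁₂ F N (theta13OfThm1CC1 F N ε₀ ε₂₉ B₃ B₃' a₀ a₁).toStage12Params { c₀ with ε₁ := ε₂₉ })
  (hleafF : ∀ P, B13FamLeafOfRecord₁₂ F N (theta13OfThm1CC1 F N ε₀ ε₂₉ B₃ B₃' a₀ a₁).toStage12Params { c₀ with ε₁ := ε₂₉ } lamF P)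
  (Ps : (k : ℕ) → (Fin (k + 1) → ℝ) → ℕ → B12.RunParams)
  (hn : ∀ k v, v ∈ Box γ₀ k → Tendsto (fun m => (lamF (Ps k v m) k v).n) atTop atTop)
  (hsp : ∀ k v, v ∈ Box γ₀ k → ∀ m, SpLaw (lamF (Ps k v m) k v)) (h213 : ∀ k v, v ∈ Box γ₀ k → ∀ m, Law213 (lamF (Ps k v m) k v))
  (hR : ∀ k v, v ∈ Box γ₀ k → ∀ m, (lamF (Ps k v m) k v).Restr)
  (hsmall₁ : 2 * ((F.L : ℝ) + 2) ^ 4 * c₀.A₁ * c₀.K₀ * ε₂₉ * Real.exp (5 * 20000 + 1) * K₀ 64 8 * 9 * 64 ≤ 1)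
  (hA₂ : Real.exp 1 * 9 * 64 * K₀ 64 8 ^ 2 ≤ c₀.A₂)
  (hs : SignsL (c13OfRecord₁₂ F N (theta13OfThm1CC1 F N ε₀ ε₂₉ B₃ B₃' a₀ a₁).toStage12Params { c₀ with ε₁ := ε₂₉ }) α₂ q.B₃)
  (Wn : (k : ℕ) → (Fin (k + 1) → ℝ) → ℕ → Type) (instW : ∀ k v m, NormedAddCommGroup (Wn k v m))
  (instWs : ∀ k v m, NormedSpace ℂ (Wn k v m))
  (emb : (k : ℕ) → (v : Fin (k + 1) → ℝ) → (m : ℕ) → TDom 4 ((lamF (Ps k v m) k v).n + 1) → Wn k v m → (lamF (Ps k v m) k v).Φ)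
  (hemb : ∀ k v, v ∈ Box γ₀ k → ∀ m X, ∀ u ∈ ball (0 : Wn k v m) α₂, emb k v m X u ∈ (lamF (Ps k v m) k v).sp2 X)
  (hH : ∀ k v, v ∈ Box γ₀ k → ∀ m (X Z : TDom 4 ((lamF (Ps k v m) k v).n + 1)), Z.1 ⊆ X.1 →
    DifferentiableOn ℂ (fun u => (lamF (Ps k v m) k v).H Z (emb k v m X u)) (ball 0 α₂))
  (D : (k : ℕ) → (v : Fin (k + 1) → ℝ) → Data190 4 M (NOfLayers fun m => lamF (Ps k v m) k v) (Wn k v) q)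
  (V : (k : ℕ) → (Fin (k + 1) → ℝ) → LDom 4 → Type) (instV : ∀ k v Y, NormedAddCommGroup (V k v Y))
  (instVs : ∀ k v Y, NormedSpace ℂ (V k v Y))
  (Fw : (k : ℕ) → (v : Fin (k + 1) → ℝ) → (Y : LDom 4) → V k v Y → ℂ)
  (hFd : ∀ k v, v ∈ Box γ₀ k → ∀ Y, ∃ ρ > 0, DifferentiableOn ℂ (Fw k v Y) (ball 0 ρ))
  (r : (k : ℕ) → (v : Fin (k + 1) → ℝ) → (m : ℕ) → (Y : LDom 4) → Wn k v m →L[ℂ] V k v Y)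
  (hfac : ∀ k v, v ∈ Box γ₀ k → ∀ Y : LDom 4, ∀ᶠ m in atTop, ∀ u ∈ ball (0 : Wn k v m) α₂,
    (lamF (Ps k v m) k v).Ek1 (tproj ((lamF (Ps k v m) k v).n + 1) Y) (emb k v m (tproj ((lamF (Ps k v m) k v).n + 1) Y) u) =
      Fw k v Y (r k v m Y u))
  (t : (k : ℕ) → (v : Fin (k + 1) → ℝ) → (Y : LDom 4) → Pt 4 → V k v Y)
  (hconv : ∀ k v, v ∈ Box γ₀ k → ∀ (Y : LDom 4) (x : Pt 4),
    Tendsto (fun m => r k v m Y ((D k v).hn m (tproj ((lamF (Ps k v m) k v).n + 1) Y) (proj (((lamF (Ps k v m) k v).n + 1) * M) x)))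
      atTop (𝓝 (t k v Y x)))
  (ha : ∀ k v, v ∈ Box γ₀ k → ∀ (Y : LDom 4) (z : Pt 4), A1 k v Y z = (mixedDeriv (Fw k v Y) (t k v Y 0) (t k v Y z)).re)

include hγ₀ hle hm hcF hleafF hn hsp h213 hR hsmall₁ hA₂ hs instW instWs hemb hH hFd hfac hconv ha

/-- **CRUX K2⁗∕K2⁵'s REGISTERED STUB `stub_d4AtSlopeCont13 : D4AtSlopeOfD1Record13` — ITS CONSEQUENT AT `(F, θ₁₅ᶜᶜ¹, Lc, Nc)` IN THE STUB's OWN LETTERS, AT THE K0 CANDIDATE MEMBER**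
`θ₁₅ᶜᶜ¹ = theta13OfThm1CC1 F N ε₀ ε₂₉ B₃ B₃' a₀ a₁`: for a (D1) datum's slope `stepBal Nc Lc`, `∃ γ₁, 0 < γ₁ ∧ γ₁ ≤ θ₁₅ᶜᶜ¹.γ ∧ AtSlopeCont (split₁₃ θ₁₅ᶜᶜ¹) γ₁ (stepBal Nc Lc)` ⇐ the family list on a box
`0 < γ₀ ≤ θ₁₅ᶜᶜ¹.γ = ½` at the FAITHFUL letters + the (1.22) identification at the ₁₃ merged β + N3 + the one-loop smallness + (C-leaf), with N1 DISCHARGED modulo the displayed `hsmall₁`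
(the open letter `ε₂₉` below the threshold) and `hA₂`, and NO κ hypothesis (p494179 §1 `d4AtSlopeOfD1Record13_at_of_family_faithful` at θ := θ₁₅ᶜᶜ¹, `hC` by §1; = p494179 §3 at the member
`n := stage12NumericsOfThm1CC1 F.L ε₀ B₃ B₃' a₀ a₁` with `hκ` paid by §0).  A REDUCTION of the stub at θ₁₅ᶜᶜ¹ — NOT a proof of it; instance 0∕1.
[cite: Balaban1988RG2Cluster, Lemma 3 (2.38) p.20 and p.21; Balaban1987RG1, (1.7) p.261, (1.18) p.263, (1.20)-(1.22) p.264, (2.9) p.266 and (5.1) p.292; Balaban1985Variational, Thm 1 p.279, (190) p.308] -/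
theorem d4AtSlopeOfD1Record13_at_theta13OfThm1CC1_of_family
    (hq : q.Valid (c13OfRecord₁₂ F N (theta13OfThm1CC1 F N ε₀ ε₂₉ B₃ B₃' a₀ a₁).toStage12Params { c₀ with ε₁ := ε₂₉ }).δ₀) {Lc : ℕ} {Nc : ℝ}
    (hsmall : ε₂₉ * remCoeffL 4 M (c13OfRecord₁₂ F N (theta13OfThm1CC1 F N ε₀ ε₂₉ B₃ B₃' a₀ a₁).toStage12Params { c₀ with ε₁ := ε₂₉ }) α₂ q.B₃ ≤
      B12Normalization.stepBal Nc Lc)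
    (hcont : ∀ k (Y : LDom 4) (z : Pt 4),
      ContinuousOn (fun v : Fin (k + 1) → ℝ => (mixedDeriv (Fw k v Y) (t k v Y 0) (t k v Y z)).re) (Box γ₀ k)) :
    letI := (theta13OfThm1CC1 F N ε₀ ε₂₉ B₃ B₃' a₀ a₁).instVβ₁; letI := (theta13OfThm1CC1 F N ε₀ ε₂₉ B₃ B₃' a₀ a₁).instVβ₂
    letI := (theta13OfThm1CC1 F N ε₀ ε₂₉ B₃ B₃' a₀ a₁).instιβ
    ∃ γ₁ : ℝ, 0 < γ₁ ∧ γ₁ ≤ (theta13OfThm1CC1 F N ε₀ ε₂₉ B₃ B₃' a₀ a₁).γ ∧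
      AtSlopeCont
        (oneLoopSplit_betaOfMerged
          (betaMerged F (mergedTermFamilyMatT F N (TcanOfRecord F N)
            (chiFixed29 F N (theta13OfThm1CC1 F N ε₀ ε₂₉ B₃ B₃' a₀ a₁).ν (theta13OfThm1CC1 F N ε₀ ε₂₉ B₃ B₃' a₀ a₁).ε₂₉)
            (theta13OfThm1CC1 F N ε₀ ε₂₉ B₃ B₃' a₀ a₁).εbg) (theta13OfThm1CC1 F N ε₀ ε₂₉ B₃ B₃' a₀ a₁).ρ8
            (theta13OfThm1CC1 F N ε₀ ε₂₉ B₃ B₃' a₀ a₁).bV)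
          (beta0OfMerged (betaMerged F (mergedTermFamilyMatT F N (TcanOfRecord F N)
            (chiFixed29 F N (theta13OfThm1CC1 F N ε₀ ε₂₉ B₃ B₃' a₀ a₁).ν (theta13OfThm1CC1 F N ε₀ ε₂₉ B₃ B₃' a₀ a₁).ε₂₉)
            (theta13OfThm1CC1 F N ε₀ ε₂₉ B₃ B₃' a₀ a₁).εbg) (theta13OfThm1CC1 F N ε₀ ε₂₉ B₃ B₃' a₀ a₁).ρ8
            (theta13OfThm1CC1 F N ε₀ ε₂₉ B₃ B₃' a₀ a₁).bV) (theta13OfThm1CC1 F N ε₀ ε₂₉ B₃ B₃' a₀ a₁).v₀)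
          (theta13OfThm1CC1 F N ε₀ ε₂₉ B₃ B₃' a₀ a₁).γ)
        γ₁ (B12Normalization.stepBal Nc Lc) :=
  d4AtSlopeOfD1Record13_at_of_family_faithful F N (theta13OfThm1CC1 F N ε₀ ε₂₉ B₃ B₃' a₀ a₁) c₀ lamF hγ₀ hle A1 hm hcF hleafF Ps hn hsp h213 hR
    (condsL_faithful_theta13OfThm1CC1_of_eps_le F N ε₀ B₃ B₃' a₀ a₁ hsmall₁ hA₂) hs Wn instW instWs emb hemb hH D V instV instVs Fw hFd r hfac t
    hconv ha hq hsmall hcont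

omit hγ₀ in
/-- **B4 ON THE BOX AT THE STAGE-13 β OF θ₁₅ᶜᶜ¹ FROM THE FAMILY ROAD + (C-pt)**, N1 DISCHARGED modulo `hsmall₁` ∕ `hA₂`, no κ hypothesis (p491248 `betaContH_betaOfRecord₁₃_of_family` at the
faithful letters of θ₁₅ᶜᶜ¹).  Instance 0∕1. [cite: Balaban1987RG1, (1.7) p.261, (1.18) p.263, (1.20)-(1.22) p.264, (2.9) p.266 and (5.10) p.293; Balaban1988RG2Cluster, Lemma 3 (2.38) p.20 and p.21; Balaban1985Variational, (190) p.308] -/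
theorem betaContH_betaOfRecord₁₃_theta13OfThm1CC1_of_family
    (hq : q.Valid (c13OfRecord₁₂ F N (theta13OfThm1CC1 F N ε₀ ε₂₉ B₃ B₃' a₀ a₁).toStage12Params { c₀ with ε₁ := ε₂₉ }).δ₀)
    (hcpt : ∀ k (x : Pt 4), ContinuousOn (fun v : Fin (k + 1) → ℝ => limKernel (A1 k v) x) (Box γ₀ k)) :
    BetaContH γ₀ (betaOfRecord₁₃ F N (theta13OfThm1CC1 F N ε₀ ε₂₉ B₃ B₃' a₀ a₁)) :=
  betaContH_betaOfRecord₁₃_of_family F N (theta13OfThm1CC1 F N ε₀ ε₂₉ B₃ B₃' a₀ a₁) { c₀ with ε₁ := ε₂₉ } lamF hle A1 hm hcF hleafF Ps hn hsp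
    h213 hR (condsL_faithful_theta13OfThm1CC1_of_eps_le F N ε₀ B₃ B₃' a₀ a₁ hsmall₁ hA₂) hs Wn instW instWs emb hemb hH D V instV instVs Fw hFd
    r hfac t hconv ha hq hcpt

/-- **N26 AT THE CORE DATUM OF RECORD OF θ₁₅ᶜᶜ¹ FROM THE FAMILY ROAD + (C-pt)** on a box `0 < γ₀ ≤ θ₁₅ᶜᶜ¹.γ = ½` (`βfun_datumOfRecord₁₃Core`, `rfl`): `∃ γc > 0, BetaContH γc
(datumOfRecord₁₃Core F N θ₁₅ᶜᶜ¹ (provisos₁₃Core_theta13OfThm1CC1 …)).βfun` at the CORE DATUM OF RECORD OF θ₁₅ᶜᶜ¹, which EXISTS AS A TERM (§0: the Core provisos are a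
theorem there — NO proviso hypothesis displayed; an item edition's datum at θ₁₅ᶜᶜ¹ is this one by proof irrelevance ∕ `rfl`), N1 DISCHARGED modulo `hsmall₁` ∕ `hA₂`, no κ hypothesis; the
ONLY displayed inputs are the (D4) family-road objects.  Instance 0∕1; N26 NOT discharged. [cite: Balaban1987RG1, (1.7) p.261, (1.18) p.263, (1.20)-(1.22) p.264, (2.9) p.266 and (5.10) p.293; Balaban1988RG2Cluster, p.15, Lemma 3 (2.38) p.20 and p.21; Balaban1985Variational, Thm 1 p.279, (190) p.308] -/
theorem n26_datumOfRecord₁₃Core_theta13OfThm1CC1_of_family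
    (hq : q.Valid (c13OfRecord₁₂ F N (theta13OfThm1CC1 F N ε₀ ε₂₉ B₃ B₃' a₀ a₁).toStage12Params { c₀ with ε₁ := ε₂₉ }).δ₀)
    (hcpt : ∀ k (x : Pt 4), ContinuousOn (fun v : Fin (k + 1) → ℝ => limKernel (A1 k v) x) (Box γ₀ k)) :
    ∃ γc : ℝ, 0 < γc ∧
      BetaContH γc (datumOfRecord₁₃Core F N (theta13OfThm1CC1 F N ε₀ ε₂₉ B₃ B₃' a₀ a₁) (provisos₁₃Core_theta13OfThm1CC1 F N ε₀ ε₂₉ B₃ B₃' a₀ a₁)).βfun :=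
  ⟨γ₀, hγ₀, betaContH_betaOfRecord₁₃_theta13OfThm1CC1_of_family F N ε₀ ε₂₉ B₃ B₃' a₀ a₁ c₀ lamF hle A1 hm hcF hleafF Ps hn hsp h213 hR hsmall₁ hA₂
    hs Wn instW instWs emb hemb hH D V instV instVs Fw hFd r hfac t hconv ha hq hcpt⟩

end RoadAtTheta15

end Summit.QuantumFields.YangMills.Theorems.BalabanUVNodesN26AtTheta13OfThm1CC1

end
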